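import Summits.SmoothPoincare4.SmoothPoincare4.Theorems.SymplecticOrigamiOrigamiFoldExistenceStubOuterCleanRecognitionChartSide
import Summits.SmoothPoincare4.SmoothPoincare4.Theorems.SymplecticOrigamiOrigamiFoldExistenceStubOuterCleanRecognitionChartSheets

/-!
# Stub `stub_outerCleanRecognitionChart` of line `shadow-pleats` for crux `OrigamiFoldExistence` — I:
# the sheet count ACROSS THE OUTER CREASE (item stmt-SmoothPoincare4-7844, route SymplecticOrigami; seat c3, S4''-chart worker)

Ninth helper file towards `stub_outerCleanRecognitionChart : OuterCleanRecognitionChart`, over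
files F (`…ChartSide`: collar data of an outer-clean chart — the open outer collar is lifted
into the EXTERIOR of the chimney, injectively, and every exterior tube point of small height
over the crease is the lifted shadow of a collar point) and G (`…ChartSheets`: the counting
sets).  Here: the LOCAL RULE at a point `y` of the outer crease off the seam sphere — the jump
`n_P(chimney side) = n_P(exterior side) - 1` of the lead's count (O2)(a): crossing `c_out` into
the chimney loses exactly the collar sheet (which lives on the exterior side: the side lemma
(O1), consumed through `CollarData`).  With `Uc = λ⁻¹(chimney)`, `Vc = λ⁻¹(exterior)` the two
sides of `c_out` in `ℝ⁴` (`chimney4`, `exterior4`; `mem_chimney4_or`), on a small ball `B`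
around `y` missing `S_ρ` (`crease_rule`, registered helper):

* EITHER (no through-sheet) `B ∩ Vc ⊆ sheet1` and `B ∩ Uc ⊆ sheet0`,
* OR (a through-sheet) `B ∩ Vc ⊆ sheet2` and `B ∩ Uc` misses `sheet0`;

and at EVERY crease point (`exists_ball_collar_witness`) the exterior points nearby carry the
collar sheet `e₀(u)`, `2 < ‖u‖ ≤ 2 + κ/2`.

Sources: the lead's `OuterClean-analysis-c3.md` §2 (O1), §3 (O2)(a); files E–G.
-/

noncomputable section

-- the prescribed namespace `Summit.<P>.<Sub>.…` duplicates `SmoothPoincare4` (P = Sub)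
set_option linter.dupNamespace false

open scoped Manifold ContDiff Topology RealInnerProductSpace
open Set Function Filter Metric
open Literature.Topology.FourManifolds Literature.Topology.FourManifolds.SphereHypersurfaceSides

namespace Summit.SmoothPoincare4.SmoothPoincare4.Theorems.OrigamiFoldExistence.ShadowPleats

/-! ### The two sides of the outer crease in `ℝ⁴` -/

section Sides

variable {M : Type} {ι : M → EuclideanSpace ℝ (Fin 5)} {e : Fin 1 → EuclideanSpace ℝ (Fin 4) → M}

/-- The CHIMNEY in `ℝ⁴`: the bounded component `U_out` of `ℝ⁴ ∖ c_out` (pull-back of the lifted chimney). -/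
def chimney4 (D : TubeData (liftedCrease ι (e 0))) : Set (EuclideanSpace ℝ (Fin 4)) := liftS4 ⁻¹' chimney D

/-- The EXTERIOR in `ℝ⁴`: the unbounded component of `ℝ⁴ ∖ c_out`. -/
def exterior4 (D : TubeData (liftedCrease ι (e 0))) : Set (EuclideanSpace ℝ (Fin 4)) := liftS4 ⁻¹' exterior D

variable (D : TubeData (liftedCrease ι (e 0)))

/-- A shadow point is on the outer crease iff its lift is on the lifted crease. -/
theorem liftS4_mem_range_iff (y : EuclideanSpace ℝ (Fin 4)) :
    liftS4 y ∈ range (liftedCrease ι (e 0)) ↔ y ∈ (proj5 ∘ ι ∘ e 0) '' Metric.sphere 0 2 := by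
  rw [range_liftedCrease]
  constructor
  · rintro ⟨u, hu, huy⟩
    exact ⟨u, hu, liftS4_injective huy⟩
  · rintro ⟨u, hu, rfl⟩
    exact ⟨u, hu, rfl⟩

/-- The chimney in `ℝ⁴` is open. -/
theorem isOpen_chimney4 : IsOpen (chimney4 D) :=
  (isOpen_chimney D (northPole_notMem_range_liftedCrease ι (e 0))).preimage contMDiff_liftS4.continuous

/-- The exterior in `ℝ⁴` is open. -/
theorem isOpen_exterior4 : IsOpen (exterior4 D) :=
  (isOpen_exterior D (northPole_notMem_range_liftedCrease ι (e 0))).preimage contMDiff_liftS4.continuous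

/-- TRICHOTOMY in `ℝ⁴`: chimney, crease, exterior. -/
theorem mem_chimney4_or (y : EuclideanSpace ℝ (Fin 4)) :
    y ∈ chimney4 D ∨ y ∈ (proj5 ∘ ι ∘ e 0) '' Metric.sphere 0 2 ∨ y ∈ exterior4 D := by
  rcases mem_chimney_or D (liftS4 y) with h | h | h
  · exact Or.inl h
  · exact Or.inr (Or.inl ((liftS4_mem_range_iff y).1
      ((sideσ_eq_zero_iff D (northPole_notMem_range_liftedCrease ι (e 0)) _).1 h)))
  · exact Or.inr (Or.inr h)

/-- The chimney and the exterior in `ℝ⁴` are disjoint. -/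
theorem disjoint_chimney4_exterior4 : Disjoint (chimney4 D) (exterior4 D) :=
  Set.disjoint_left.2 fun _ h1 h2 => Set.disjoint_left.1 (disjoint_chimney_exterior D) h1 h2

/-- The exterior in `ℝ⁴` misses the crease. -/
theorem not_mem_crease_of_mem_exterior4 {y : EuclideanSpace ℝ (Fin 4)} (hy : y ∈ exterior4 D) :
    y ∉ (proj5 ∘ ι ∘ e 0) '' Metric.sphere 0 2 := fun h =>
  Set.disjoint_left.1 (disjoint_exterior_range D (northPole_notMem_range_liftedCrease ι (e 0))) hy
    ((liftS4_mem_range_iff y).2 h)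

/-- The chimney in `ℝ⁴` misses the crease. -/
theorem not_mem_crease_of_mem_chimney4 {y : EuclideanSpace ℝ (Fin 4)} (hy : y ∈ chimney4 D) :
    y ∉ (proj5 ∘ ι ∘ e 0) '' Metric.sphere 0 2 := fun h =>
  Set.disjoint_left.1 (disjoint_chimney_range D (northPole_notMem_range_liftedCrease ι (e 0))) hy
    ((liftS4_mem_range_iff y).2 h)

/-! ### The tube around the crease, read in `ℝ⁴` -/

/-- The OPEN TUBE of height `t₁` around the lifted crease is open. -/
theorem isOpen_image_tube (t₁ : ℝ) :
    IsOpen (D.τ '' (univ ×ˢ {w : EuclideanSpace ℝ (Fin 1) | |w 0| < t₁})) :=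
  D.isOpenEmbedding.isOpenMap _ (isOpen_univ.prod
    (isOpen_lt (continuous_abs.comp ((EuclideanSpace.proj (0 : Fin 1)).continuous)) continuous_const))

/-- A crease point lies in every open tube of positive height. -/
theorem liftS4_mem_image_tube {t₁ : ℝ} (ht₁ : 0 < t₁) {y : EuclideanSpace ℝ (Fin 4)}
    (hy : y ∈ (proj5 ∘ ι ∘ e 0) '' Metric.sphere 0 2) :
    liftS4 y ∈ D.τ '' (univ ×ˢ {w : EuclideanSpace ℝ (Fin 1) | |w 0| < t₁}) := by
  obtain ⟨x, hx⟩ := (liftS4_mem_range_iff y).2 hy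
  refine ⟨(x, 0), ⟨mem_univ _, by simpa using ht₁⟩, ?_⟩
  rw [D.apply_zero, hx]

/-- In the tube of height `≤ 1/4` the side is read off the fibre coordinate: EXTERIOR iff the
pole-signed height is positive. -/
theorem τ_mem_exterior_iff (x : Metric.sphere (0 : EuclideanSpace ℝ (Fin 4)) 1) (w : EuclideanSpace ℝ (Fin 1))
    (hw : |w 0| ≤ 1 / 4) : D.τ (x, w) ∈ exterior D ↔ 0 < poleSign D * w 0 := by
  show 0 < sideσ D (D.τ (x, w)) ↔ _
  rw [sideσ_tube D x w hw]

/-- In the tube of height `≤ 1/4`: CHIMNEY iff the pole-signed height is negative. -/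
theorem τ_mem_chimney_iff (x : Metric.sphere (0 : EuclideanSpace ℝ (Fin 4)) 1) (w : EuclideanSpace ℝ (Fin 1))
    (hw : |w 0| ≤ 1 / 4) : D.τ (x, w) ∈ chimney D ↔ poleSign D * w 0 < 0 := by
  show sideσ D (D.τ (x, w)) < 0 ↔ _
  rw [sideσ_tube D x w hw]

end Sides

/-! ### The collar sheet over the exterior side -/

section Crease

variable {M : Type} [TopologicalSpace M] [ChartedSpace (EuclideanSpace ℝ (Fin 4)) M]
  {ι : M → EuclideanSpace ℝ (Fin 5)} {δ : ℝ} {e : Fin 1 → EuclideanSpace ℝ (Fin 4) → M}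
  {D : TubeData (liftedCrease ι (e 0))}

/-- Chart points outside the closed chart ball `B̄₂` are in the outer part. -/
theorem chart_mem_outerPart (h : IsPleatedPosition ι δ e) {u : EuclideanSpace ℝ (Fin 4)} (hu : 2 < ‖u‖) :
    e 0 u ∈ outerPart ι δ (e 0) := by
  refine ⟨(h.2.2.2.2.1 0).2 u, ?_⟩
  rintro ⟨u', hu', heq⟩
  rw [(h.2.2.2.2.1 0).1.isEmbedding.injective heq, mem_closedBall_zero_iff] at hu'
  linarith

omit [TopologicalSpace M] [ChartedSpace (EuclideanSpace ℝ (Fin 4)) M] in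
/-- A point of the closed outer part in the chart shell `e₀(foldShell κ)` is a chart point of the
closed outer collar `{2 ≤ ‖u‖ < 2 + κ}`. -/
theorem exists_eq_chart_of_mem_outerPartK {κ : ℝ} {m : M} (hm : m ∈ outerPartK ι δ (e 0))
    (hmN : m ∈ e 0 '' foldShell κ) : ∃ u : EuclideanSpace ℝ (Fin 4), 2 ≤ ‖u‖ ∧ ‖u‖ < 2 + κ ∧ m = e 0 u := by
  obtain ⟨u, hu, rfl⟩ := hmN
  refine ⟨u, ?_, hu.2, rfl⟩
  by_contra hlt
  exact hm.2 ⟨u, mem_ball_zero_iff.2 (not_le.1 hlt), rfl⟩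

omit [TopologicalSpace M] [ChartedSpace (EuclideanSpace ℝ (Fin 4)) M] in
/-- **THE COLLAR SHEET**: near every point of the outer crease, every point of the EXTERIOR is
the shadow of a point `e₀(u)` of the open outer collar, `2 < ‖u‖ ≤ 2 + κ/2` (local surjectivity
of the collar onto the exterior side of the tube). -/
theorem exists_ball_collar_witness (cd : CollarData D) {y : EuclideanSpace ℝ (Fin 4)}
    (hy : y ∈ (proj5 ∘ ι ∘ e 0) '' Metric.sphere 0 2) :
    ∃ ε : ℝ, 0 < ε ∧ ∀ z ∈ Metric.ball y ε, z ∈ exterior4 D →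
      ∃ u : EuclideanSpace ℝ (Fin 4), 2 < ‖u‖ ∧ ‖u‖ ≤ 2 + cd.h.κ / 2 ∧ (proj5 ∘ ι ∘ e 0) u = z := by
  set T := D.τ '' (univ ×ˢ {w : EuclideanSpace ℝ (Fin 1) | |w 0| < cd.t₀}) with hT
  have hTopen : IsOpen (liftS4 ⁻¹' T) := (isOpen_image_tube D cd.t₀).preimage contMDiff_liftS4.continuous
  obtain ⟨ε, hε, hball⟩ := Metric.isOpen_iff.1 hTopen y (liftS4_mem_image_tube D cd.t₀_pos hy)
  refine ⟨ε, hε, fun z hz hzV => ?_⟩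
  obtain ⟨⟨x, w⟩, ⟨-, hw⟩, hτ⟩ := hball hz
  have hw' : |w 0| < cd.t₀ := hw
  have hwle : |w 0| ≤ 1 / 4 := (hw'.le.trans cd.t₀_le)
  have hpos : 0 < poleSign D * w 0 := (τ_mem_exterior_iff D x w hwle).1 (by rw [hτ]; exact hzV)
  have hle : poleSign D * w 0 ≤ cd.t₀ := by
    rcases poleSign_eq_or D (northPole_notMem_range_liftedCrease ι (e 0)) with hs | hs <;>
      · rw [hs]; nlinarith [abs_lt.1 hw']
  obtain ⟨u, hu2, huκ, hGu⟩ := cd.localSurj x (w 0) hpos.le hle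
  have hGu' : liftS4 ((proj5 ∘ ι ∘ e 0) u) = liftS4 z := by rw [hGu, smul_e₀_eq, hτ]
  have hz : (proj5 ∘ ι ∘ e 0) u = z := liftS4_injective hGu'
  refine ⟨u, lt_of_le_of_ne hu2 fun heq => ?_, huκ, hz⟩
  exact not_mem_crease_of_mem_exterior4 D hzV ⟨u, mem_sphere_zero_iff_norm.2 heq.symm, hz⟩

variable [T2Space M] [CompactSpace M] [IsManifold (𝓡 4) ∞ M]

/-- **THE CREASE RULE** (registered helper of file I).  At a point `y` of the outer crease off
the seam sphere there is a ball `B` around `y` missing `S_ρ` such that EITHER the exterior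
part of `B` has exactly one sheet and the chimney part none, OR the exterior part has at least
two sheets and the chimney part at least one. [folklore] -/
theorem crease_rule (h : IsPleatedPosition ι δ e) (cd : CollarData D) {y : EuclideanSpace ℝ (Fin 4)} (hy : y ∈ (proj5 ∘ ι ∘ e 0) '' Metric.sphere 0 2) (hyρ : ‖y‖ ≠ Real.sqrt (1 - (1 - δ) ^ 2)) : ∃ ε : ℝ, 0 < ε ∧ Disjoint (Metric.ball y ε) (Metric.sphere (0 : EuclideanSpace ℝ (Fin 4)) (Real.sqrt (1 - (1 - δ) ^ 2))) ∧ (((∀ z ∈ Metric.ball y ε, z ∈ exterior4 D → z ∈ sheet1 ι δ (e 0)) ∧ (∀ z ∈ Metric.ball y ε, z ∈ chimney4 D → z ∈ sheet0 ι δ (e 0))) ∨ ((∀ z ∈ Metric.ball y ε, z ∈ exterior4 D → z ∈ sheet2 ι δ (e 0)) ∧ (∀ z ∈ Metric.ball y ε, z ∈ chimney4 D → z ∉ sheet0 ι δ (e 0)))) := by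
  set ρ := Real.sqrt (1 - (1 - δ) ^ 2) with hρ
  set G := proj5 ∘ ι ∘ e 0 with hGdef
  have he := (h.2.2.2.2.1 0).1
  set κ := cd.h.κ with hκdef
  have hκ : 0 < κ := cd.h.pos
  -- a ball missing the seam sphere, with the collar sheet over its exterior part
  obtain ⟨εS, hεS, hballS⟩ := Metric.isOpen_iff.1
    (isClosed_sphere : IsClosed (Metric.sphere (0 : EuclideanSpace ℝ (Fin 4)) ρ)).isOpen_compl y
    (fun hy' => hyρ (mem_sphere_zero_iff_norm.1 hy'))
  obtain ⟨εW, hεW, hwit⟩ := exists_ball_collar_witness cd hy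
  -- the chart shell around the fold sphere and the shadow of the rest of `P̄⁺`
  set N₁ : Set M := e 0 '' foldShell κ with hN₁
  have hN₁open : IsOpen N₁ := isOpenMap_pleatChart he _ (isOpen_foldShell κ)
  set F := (proj5 ∘ ι) '' (outerPartK ι δ (e 0) \ N₁) with hF
  have hFclosed : IsClosed F := isClosed_shadow_outerPartK_diff h hN₁open
  -- chart points of the open collar are exterior points
  have hVc : ∀ u : EuclideanSpace ℝ (Fin 4), 2 < ‖u‖ → ‖u‖ < 2 + κ → G u ∈ exterior4 D :=
    fun u hu1 hu2 => cd.mem_exterior u hu1 hu2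
  by_cases hyF : y ∈ F
  · -- CASE (b): a through-sheet `c ∈ P⁺` over `y`, away from the chart ball `e₀(B̄_{2+κ/2})`
    obtain ⟨c, ⟨hcK, hcN₁⟩, hcy⟩ := hyF
    have hcP : c ∈ outerPart ι δ (e 0) := by
      by_contra hcP
      rcases apply_eq_or_mem_of_mem_diff hcK hcP with hseam | ⟨u, hu, rfl⟩
      · exact hyρ (by rw [← hcy]; exact norm_shadow_of_seam h.2.2.2.1 hseam)
      · exact hcN₁ ⟨u, mem_foldShell_of_norm hκ (mem_sphere_zero_iff_norm.1 hu), rfl⟩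
    have hcfar : c ∉ e 0 '' Metric.closedBall 0 (2 + κ / 2) := by
      rintro ⟨u, hu, rfl⟩
      rw [mem_closedBall_zero_iff] at hu
      by_cases hlt : ‖u‖ < 2
      · exact hcK.2 ⟨u, mem_ball_zero_iff.2 hlt, rfl⟩
      · exact hcN₁ ⟨u, ⟨by linarith [not_lt.1 hlt], by linarith⟩, rfl⟩
    have hWfar : IsOpen (e 0 '' Metric.closedBall (0 : EuclideanSpace ℝ (Fin 4)) (2 + κ / 2))ᶜ :=
      ((isCompact_closedBall (0 : EuclideanSpace ℝ (Fin 4)) _).image he.contMDiff.continuous).isClosed.isOpen_compl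
    obtain ⟨Uc, hUc, hcUc, hUcW, -, himgc⟩ := exists_nhds_injOn_outerPart h hcP hWfar hcfar
    obtain ⟨ε₁, hε₁, hball₁⟩ := Metric.isOpen_iff.1 (himgc Uc Subset.rfl hUc) y ⟨c, hcUc, hcy⟩
    refine ⟨min εS (min εW ε₁), by positivity, ?_, Or.inr ⟨fun z hz hzV => ?_, fun z hz _ hz0 => ?_⟩⟩
    · exact Set.disjoint_left.2 fun z hz hzS => hballS (Metric.ball_subset_ball (min_le_left _ _) hz) hzS
    · obtain ⟨a, haUc, haz⟩ := hball₁ (Metric.ball_subset_ball ((min_le_right _ _).trans (min_le_right _ _)) hz)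
      obtain ⟨u, hu2, huκ, huz⟩ := hwit z (Metric.ball_subset_ball ((min_le_right _ _).trans (min_le_left _ _)) hz) hzV
      have hne : a ≠ e 0 u := fun heq => (hUcW haUc).1 ⟨u, mem_closedBall_zero_iff.2 huκ, heq.symm⟩
      exact ⟨a, (hUcW haUc).2, e 0 u, chart_mem_outerPart h hu2, hne, haz, huz⟩
    · obtain ⟨a, haUc, haz⟩ := hball₁ (Metric.ball_subset_ball ((min_le_right _ _).trans (min_le_right _ _)) hz)
      exact hz0 a (hUcW haUc).2 haz
  · -- CASE (a): no through-sheet over `y`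
    obtain ⟨ε₁, hε₁, hball₁⟩ := Metric.isOpen_iff.1 hFclosed.isOpen_compl y hyF
    -- every `P̄⁺`-preimage of a point of the ball is a chart point of the closed collar
    have hpre : ∀ z ∈ Metric.ball y ε₁, ∀ m ∈ outerPartK ι δ (e 0), proj5 (ι m) = z →
        ∃ u : EuclideanSpace ℝ (Fin 4), 2 ≤ ‖u‖ ∧ ‖u‖ < 2 + κ ∧ m = e 0 u := by
      intro z hz m hm hmz
      have hmN₁ : m ∈ N₁ := by
        by_contra hnot
        exact hball₁ hz ⟨m, ⟨hm, hnot⟩, hmz⟩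
      exact exists_eq_chart_of_mem_outerPartK hm hmN₁
    refine ⟨min εS (min εW ε₁), by positivity, ?_, Or.inl ⟨fun z hz hzV => ?_, fun z hz hzU => ?_⟩⟩
    · exact Set.disjoint_left.2 fun z hz hzS => hballS (Metric.ball_subset_ball (min_le_left _ _) hz) hzS
    · have hz₁ : z ∈ Metric.ball y ε₁ := Metric.ball_subset_ball ((min_le_right _ _).trans (min_le_right _ _)) hz
      obtain ⟨u, hu2, huκ, huz⟩ := hwit z (Metric.ball_subset_ball ((min_le_right _ _).trans (min_le_left _ _)) hz) hzV
      refine ⟨e 0 u, chart_mem_outerPart h hu2, huz, fun m' hm' hm'z => ?_⟩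
      obtain ⟨u', hu'2, hu'κ, rfl⟩ := hpre z hz₁ m' (outerPart_subset_outerPartK hm') hm'z
      have := cd.injOn ⟨hu'2, hu'κ⟩ ⟨hu2.le, by linarith⟩ (hm'z.trans huz.symm)
      rw [this]
    · have hz₁ : z ∈ Metric.ball y ε₁ := Metric.ball_subset_ball ((min_le_right _ _).trans (min_le_right _ _)) hz
      intro m' hm' hm'z
      obtain ⟨u', hu'2, hu'κ, rfl⟩ := hpre z hz₁ m' (outerPart_subset_outerPartK hm') hm'z
      have hu'gt : 2 < ‖u'‖ := by
        refine lt_of_le_of_ne hu'2 fun heq => hm'.2 ⟨u', mem_closedBall_zero_iff.2 (le_of_eq heq.symm), rfl⟩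
      have hzV : z ∈ exterior4 D := hm'z ▸ hVc u' hu'gt hu'κ
      exact Set.disjoint_left.1 (disjoint_chimney4_exterior4 D) hzU hzV

end Crease

end Summit.SmoothPoincare4.SmoothPoincare4.Theorems.OrigamiFoldExistence.ShadowPleats

end
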